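import Summits.RiemannHypothesis.RiemannHypothesis.Theorems.DBNNearFieldNewman
import HarnessLib

/-!
# T-candidate «NEAR-FIELD NEWMAN» — v2 DELTA: the typed β-structure (sup form, collision supply, dip lemma,
real-zero destruction)

The declarations that rh-idea-2 g2's `T-NearFieldNewman.lean` v2 (`pub/ideators/rh-idea-2/T-NearFieldNewman.lean`,
sha16 eddb357177413014, 137 l) APPENDS to v1 (adfd703a94c8fd91 = tree `Theorems/DBNNearFieldNewman.lean`, landing #669,
whose `NearFieldNewman` / `LaguerreDifferenceNewman` / `laguerreDifferenceNewman_of_nearFieldNewman` /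
`not_hyperbolic_of_neg` are imported, not restated), VERBATIM and in order: `HasDip`, `nearFieldNewman_iff`,
`SupNearFieldNewman` (β ≥ 0, sup form), `supNearFieldNewman_of_nearFieldNewman`, `CollisionSupply` (RH-free, open),
`DipAfterDoubleZero` (RH-free local lemma, provable), the kernel glue `supNearFieldNewman_of_collisionSupply`,
`RealZeroDestruction s`, `RealZeroDestructionSupply` — the T-structure
`RealZeroDestructionSupply ⟹ CollisionSupply ⟹ (with DipAfterDoubleZero) SupNearFieldNewman ⟸ NearFieldNewman`.
Statements only plus two proved glue lemmas; every `def … : Prop` here is an OPEN RH-free question or a provable local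
lemma stated as a hypothesis, never asserted.  NOT in any `closes` cone (BN-1); referee rh-split-ref g10 (T56 candidate);
filed by rh-split-typer-5 under lead g9 RULINGS #352 (a)(2) / #356, `--supports stmt-RiemannHypothesis-0278`, 0 width
(director 23:27:49Z «at leisure»).  The M1-repaired weak form, if rh-idea-2 writes one, is NOT here (their pen, not a
typer's).  Nothing here bears on the truth of RH.
-/

noncomputable section

-- D-0017: `Summit.RiemannHypothesis.RiemannHypothesis.…` duplicates the namespace BY DESIGN (single-problem summit).
set_option linter.dupNamespace false

namespace Summit.RiemannHypothesis.RiemannHypothesis.Cruxes.DBN.NearFieldNewman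

open Literature.NumberTheory.LFunctions

/-- A non-crossing dip of `H_t` at the real point `c` (the predicate of `NearFieldNewman`). -/
def HasDip (t c : ℝ) : Prop :=
  deriv (fun u : ℝ => (deBruijnH t (u : ℂ)).re) c = 0 ∧ (deBruijnH t (c : ℂ)).re ≠ 0 ∧
    0 ≤ (deBruijnH t (c : ℂ)).re * iteratedDeriv 2 (fun u : ℝ => (deBruijnH t (u : ℂ)).re) c

/-- `NearFieldNewman` unfolds to «for every `t < 0` some real `c` is a non-crossing dip» (`HasDip t c`). -/
theorem nearFieldNewman_iff : NearFieldNewman ↔ ∀ t : ℝ, t < 0 → ∃ c : ℝ, HasDip t c := Iff.rfl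

/-- **Sup form (β ≥ 0 proper): dips occur at backward times accumulating at 0.**  (`β := sup {t : ∃ c, HasDip t c}`;
this says `β ≥ 0`.)  METER (U) (kit j293553, design-grade): at the Lehman site dips exist for every grid
`t ≤ −1.5·10⁻⁴` and the pair's collision time is `t* = −1.08·10⁻⁴`, so `β ≥ t*` there. -/
def SupNearFieldNewman : Prop :=
  ∀ ε : ℝ, 0 < ε → ∃ t : ℝ, -ε < t ∧ t < 0 ∧ ∃ c : ℝ, HasDip t c

/-- The strong form (a dip at EVERY `t < 0`) gives the sup form (dips at backward times accumulating at `0`). -/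
theorem supNearFieldNewman_of_nearFieldNewman (h : NearFieldNewman) : SupNearFieldNewman := by
  intro ε hε
  obtain ⟨c, hc⟩ := h (-(ε / 2)) (by linarith)
  exact ⟨-(ε / 2), by linarith, by linarith, c, hc⟩

/-- **COLLISION SUPPLY (RH-free, open): exactly-double REAL zeros of `H_t` occur at backward times accumulating at 0.**
Mechanism (METER (U) coarse window): under the backward flow `s = −t ↑` (Gaussian smoothing `e^{s∂²}`, since
`∂_t H_t = −H_t″`) consecutive real zeros ATTRACT and collide; a pair with gap `g` isolated in the CSV sense collides at
`s ≈ g²/8` (Lehman pair: predicted 1.125·10⁻⁴, measured 1.081·10⁻⁴).  Sufficient inputs, each open or unbuilt: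
(i) infinitely many Lehmer pairs in the sense of Csordas–Smith–Varga 1994 (`g²·G_k < 4/5`; Rodgers–Tao 2020 avoid this);
(ii) `RealZeroDestruction` below + continuity of zeros in `t`. -/
def CollisionSupply : Prop :=
  ∀ ε : ℝ, 0 < ε → ∃ t : ℝ, -ε < t ∧ t < 0 ∧
    ∃ x : ℝ, deBruijnH t (x : ℂ) = 0 ∧ deriv (deBruijnH t) (x : ℂ) = 0 ∧ iteratedDeriv 2 (deBruijnH t) (x : ℂ) ≠ 0

/-- **DIP AFTER A DOUBLE ZERO (RH-free local lemma, provable, size M): just BACKWARD of an exactly-double real zero of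
`H_{t₀}` at `x`, `H_t` has a non-crossing dip near `x`.**  Heat normal form: `H_t(z) ≈ a[(z − x)² + 2(t₀ − t)]`, so for
`t < t₀` close to `t₀`: no real zero near `x`, a critical point `c(t) → x`, and `H_t(c)·H_t″(c) ≈ 4a²(t₀ − t) > 0`.
(Implicit function theorem for `∂_u Re H_t(u) = 0` near `(t₀, x)` using `∂_t H = −H″`, `H″(x) = 2a ≠ 0`.) -/
def DipAfterDoubleZero : Prop :=
  ∀ t₀ x : ℝ, deBruijnH t₀ (x : ℂ) = 0 → deriv (deBruijnH t₀) (x : ℂ) = 0 → iteratedDeriv 2 (deBruijnH t₀) (x : ℂ) ≠ 0 →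
    ∀ δ : ℝ, 0 < δ → ∃ t : ℝ, t₀ - δ < t ∧ t < t₀ ∧ ∃ c : ℝ, HasDip t c

/-- KERNEL GLUE: collision supply + the local dip lemma give `β ≥ 0` (sup form). -/
theorem supNearFieldNewman_of_collisionSupply (hC : CollisionSupply) (hD : DipAfterDoubleZero) :
    SupNearFieldNewman := by
  intro ε hε
  obtain ⟨t₀, ht₀, ht₀', x, h0, h1, h2⟩ := hC ε hε
  obtain ⟨t, ht, ht', c, hc⟩ := hD t₀ x h0 h1 h2 (t₀ + ε) (by linarith)
  exact ⟨t, by linarith, by linarith, c, hc⟩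

/-- **REAL-ZERO DESTRUCTION at backward time `s` (RH-free, Levinson-type T-candidate): some window loses real zeros.**
There is a window `(a, b)` whose endpoints stay off the zeros of `H_t` for all `t ∈ [−s, 0]` (so no zero enters or
leaves through the boundary) and in which `H_{−s}` has strictly fewer real zeros than `H_0`.  METER (U): at height
`x ≈ 1.43·10⁵` (spacing `δ ≈ 1.34`) the window `x0 ± 10` goes 15 → 13 → 9 → 7 → 3 real zeros for `s = 0.05, 0.1, 0.2, 0.3`.
For EACH FIXED `s` this is a finite certificate (one window); the family over all `s > 0` needs height → ∞ (`δ(γ) → 0`).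
A Lehmer-free analytic route: show the real zeros of `H_{−s}` have upper density `< 2/5` of `N(T)` and invoke Conrey's
`2/5` for `H_0`. -/
def RealZeroDestruction (s : ℝ) : Prop :=
  ∃ a b : ℝ, a < b ∧
    (∀ t : ℝ, -s ≤ t → t ≤ 0 → deBruijnH t (a : ℂ) ≠ 0 ∧ deBruijnH t (b : ℂ) ≠ 0) ∧
    {x : ℝ | a < x ∧ x < b ∧ deBruijnH (-s) (x : ℂ) = 0}.ncard < {x : ℝ | a < x ∧ x < b ∧ deBruijnH 0 (x : ℂ) = 0}.ncard

/-- The family statement «destruction before every positive backward time». With continuity of the zero set in `t`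
(Hurwitz) it yields a multiple real zero at some `t ∈ [−s, 0)`, i.e. `CollisionSupply` up to the exact-multiplicity
clause (generic; a refinement of the window argument handles it).  Recorded as the T-structure
`RealZeroDestructionSupply ⟹ CollisionSupply ⟹ (with DipAfterDoubleZero) SupNearFieldNewman ⟸ NearFieldNewman`. -/
def RealZeroDestructionSupply : Prop := ∀ s : ℝ, 0 < s → RealZeroDestruction s

end Summit.RiemannHypothesis.RiemannHypothesis.Cruxes.DBN.NearFieldNewman

end
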